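import Summits.Schanuel.Schanuel.Theses.TateNomes
import HarnessLib

/-!
# Crux-strategist (gen 1) census sketch for `TateLocusGPC` (stmt-Schanuel-17404, route `TateNomes`)

NOT a line, NOT registered.  Typed statements referenced by `STRATEGY-CENSUS.md` (v2):

* `jOfNome q` — the modular invariant of the nome, `1728 Q³/(Q³ − R²)` with `Q, R` Ramanujan's
  inline `q`-series of the route file (so `jOfNome (e^{w j})` is `j(τⱼ)`, `τⱼ = wⱼ/2πi`).
* `TatePosition m w` — the five hypotheses of the crux, verbatim.
* NEGATION / weakest-unknown-consequence ladder (each implied by the crux, none implied by Schanuel,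
  none known; see census §Negation):
  - `ModularHermite`      — in Tate position not all `j(τⱼ)` are algebraic (m-nome "Stéphanois",
                             the ℚ-linear slice of the modular Schanuel conjecture);
  - `CoincidenceBudget`   — `#{j : wⱼ ∈ ℚ̄} + #{j : j(τⱼ) ∈ ℚ̄} ≤ m − 1` in Tate position;
  - `JExpTranscendental`  — Lindemann-dual Mahler–Manin: `J(e^{−β}) ∉ ℚ̄` for algebraic `β`, `Re β > 0`.
  - the implications `TateLocusGPC → …` as Props (`…OfCrux`): provable now by trdeg bookkeeping
    (+ `transcendental_pi_holds` for the hypotheses of the `JExp` tuple), recorded for a prover.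
* TRANSFER target short of the crux (census §Transfer, the only statement a 2-variable Nesterenko
  scheme could formally reach if its Lemma 3.3 existed): `DependentTripleNesterenko k`.
* DECOMPOSITION D-1 re-typed (b1 census): `TateEllipticGPC`, `TateToricBridge`, glue proved.
-/

noncomputable section

-- single-conjunct summit: `Summit.Schanuel.Schanuel.…` repeats the name by the D-0017 layout
set_option linter.dupNamespace false

namespace Summit.Schanuel.Schanuel.Cruxes.TateLocusGPC.StrategistG1

open Summit.Schanuel.Schanuel.Theses.TateNomes (TateLocusGPC)

/-- Ramanujan's `Q = E₄` as the route's inline `q`-series. -/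
def ramQ (q : ℂ) : ℂ := 1 + 240 * ∑' l : ℕ, (ArithmeticFunction.sigma 3 (l + 1) : ℂ) * q ^ (l + 1)

/-- Ramanujan's `R = E₆` as the route's inline `q`-series. -/
def ramR (q : ℂ) : ℂ := 1 - 504 * ∑' l : ℕ, (ArithmeticFunction.sigma 5 (l + 1) : ℂ) * q ^ (l + 1)

/-- Ramanujan's `P = E₂` as the route's inline `q`-series. -/
def ramP (q : ℂ) : ℂ := 1 - 24 * ∑' l : ℕ, (ArithmeticFunction.sigma 1 (l + 1) : ℂ) * q ^ (l + 1)

/-- The modular invariant of a nome: `J(q) = 1728 Q(q)³ / (Q(q)³ − R(q)²)` (`= j(τ)` for `q = e^{2πiτ}`;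
junk `0` where `Q³ = R²`, which does not happen for `0 < |q| < 1`). -/
def jOfNome (q : ℂ) : ℂ := 1728 * ramQ q ^ 3 / (ramQ q ^ 3 - ramR q ^ 2)

/-- The period ratio attached to a Schanuel coordinate: `τ = w / 2πi`. -/
def tauOf (w : ℂ) : ℂ := w / (2 * (Real.pi : ℂ) * Complex.I)

/-- The five hypotheses of the crux ("Tate position"), verbatim from the route decl. -/
def TatePosition (m : ℕ) (w : Fin m → ℂ) : Prop :=
  LinearIndependent ℚ w ∧
  (2 * (Real.pi : ℂ) * Complex.I) ∈ Submodule.span ℚ (Set.range w) ∧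
  (∀ j, (w j).re < 0) ∧
  (∀ j, ∀ b c : ℚ, tauOf (w j) ^ 2 + (b : ℂ) * tauOf (w j) + (c : ℂ) ≠ 0) ∧
  (∀ i j, i ≠ j → ∀ a b c d : ℚ, 0 < a * d - b * c →
    tauOf (w j) * ((c : ℂ) * tauOf (w i) + (d : ℂ)) ≠ (a : ℂ) * tauOf (w i) + (b : ℂ))

/-! ## Negation / weakest-unknown-consequence ladder -/

/-- **ModularHermite** (m-nome Stéphanois; the `ℚ`-linear slice of the modular Schanuel conjecture):
in Tate position not all of the `m` moduli `j(τⱼ)` are algebraic.  Vacuous for `m ≤ 2`; at `m = 3`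
it says: for `τ₁, τ₂ ∈ ℍ` with `τ₁, τ₂, τ₁ + τ₂` non-quadratic and pairwise `GL₂⁺(ℚ)`-inequivalent,
`j(τ₁), j(τ₂), j(τ₁ + τ₂)` are not all algebraic (equivalently: nomes `q₁, q₂, q₁q₂` of three pairwise
non-isogenous non-CM `ℚ̄`-curves never occur).  Crux ⇒ this (`modularHermiteOfCrux`); GPC for
`h¹(E₁)⊕h¹(E₂)⊕h¹(E₃)` ⇒ this; Schanuel does not imply it; OPEN (LNM 1752 Ch. 2 §4; arXiv:2505.08570 §1:
"a result of Stéphanois type is unknown" in several `q`-variables). -/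
def ModularHermite : Prop :=
  ∀ (m : ℕ) (w : Fin m → ℂ), TatePosition m w → ∃ j, Transcendental ℚ (jOfNome (Complex.exp (w j)))

/-- **CoincidenceBudget**: in Tate position the number of algebraic logarithms `wⱼ` plus the number of
algebraic moduli `j(τⱼ)` is at most `m − 1` (each costs one transcendence degree of the envelope, whose
generic count is `5m − 1` against the crux's `4m`).  The extreme cases are `ModularHermite` (`k = m`) and
`JExpTranscendental` (`a = m − 1, k = 1`); Lindemann (`π ∉ ℚ̄`) alone gives `a ≤ m − 1`. Crux ⇒ this. -/
def CoincidenceBudget : Prop :=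
  ∀ (m : ℕ) (w : Fin m → ℂ), TatePosition m w →
    {j | IsAlgebraic ℚ (w j)}.ncard + {j | IsAlgebraic ℚ (jOfNome (Complex.exp (w j)))}.ncard ≤ m - 1

/-- **JExpTranscendental** (Lindemann-dual Mahler–Manin): for every algebraic `β` with `Re β > 0`,
`J(e^{−β}) = j(iβ/2π)` is transcendental.  (Mahler–Manin = BDGP 1996 is the case "`q` algebraic";
Manin's general conjecture "`α^τ, j(τ)` not both algebraic" is the case "`log q / log α ∈ ℍ`",
Murty–Rath, Transcendental Numbers, Ch. 17, p. 56, OPEN; this is the case "`log q` algebraic".)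
Crux at `m = 3` ⇒ this (`jExpTranscendentalOfCrux`, tuple `w = (−β, −√2β, 2πi − β − √2β)`);
`TateLocusGPCOne` ⇒ this; Conj. 1.11 and Schanuel do not; no theorem decides it. -/
def JExpTranscendental : Prop :=
  ∀ β : ℂ, IsAlgebraic ℚ β → 0 < β.re → Transcendental ℚ (jOfNome (Complex.exp (-β)))

/-- `TateLocusGPC → ModularHermite` — provable now: if all `m` moduli are algebraic then each `Rⱼ` is
algebraic over `ℚ(Qⱼ)` (`R² = Q³(1 − 1728/j)`, and `Q³ = R²` in the junk case), the nomes satisfy one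
multiplicative relation (`2πi ∈ span_ℚ w`), so `trdeg Env ≤ m + (m−1) + m + m = 4m − 1 < 4m`. -/
def ModularHermiteOfCrux : Prop := TateLocusGPC → ModularHermite

/-- `TateLocusGPC → CoincidenceBudget` — provable now by the same bookkeeping
(`trdeg Env ≤ 5m − 1 − a − k`). -/
def CoincidenceBudgetOfCrux : Prop := TateLocusGPC → CoincidenceBudget

/-- `TateLocusGPC → JExpTranscendental` — provable now: the tuple `(−β, −√2·β, 2πi − (1+√2)β)` is in Tate
position (`π ∉ ℚ̄`, tree `transcendental_pi_holds`, gives linear independence, non-quadraticity and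
pairwise inequivalence), has `a = 2` algebraic logarithms, so an algebraic `J(e^{−β})` caps
`trdeg Env ≤ 1 + 2 + 3 + 3 + 2 = 11 < 12`. -/
def JExpTranscendentalOfCrux : Prop := TateLocusGPC → JExpTranscendental

/-! ## Transfer target short of the crux -/

/-- **DependentTripleNesterenko k**: at two nomes and their product, the eleven numbers
`q₁, q₂, (P,Q,R)(q₁), (P,Q,R)(q₂), (P,Q,R)(q₁q₂)` carry at least `k` algebraically independent ones
whenever `τ₁, τ₂, τ₁+τ₂` are non-quadratic and pairwise inequivalent.  Known: `k = 3` (Nesterenko at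
one nome).  `k = 4` would be the first joint theorem at two nomes; `k = 5` is what a two-variable
Nesterenko scheme would formally certify IF its interpolation lemma (LNM 1752 Ch. 3 Lemma 3.3) had a
two-variable analogue (census §Transfer: it does not); `k = 9` (= `MultiNomeNesterenko` at this tuple)
⇒ `ModularHermite` at `m = 3`.  Re-arm trigger, not a stub. -/
def DependentTripleNesterenko (k : ℕ) : Prop :=
  ∀ τ₁ τ₂ : ℂ, 0 < τ₁.im → 0 < τ₂.im →
    (∀ τ ∈ ({τ₁, τ₂, τ₁ + τ₂} : Set ℂ), ∀ b c : ℚ, τ ^ 2 + (b : ℂ) * τ + (c : ℂ) ≠ 0) →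
    (∀ τ ∈ ({τ₁, τ₂, τ₁ + τ₂} : Set ℂ), ∀ σ ∈ ({τ₁, τ₂, τ₁ + τ₂} : Set ℂ), τ ≠ σ →
      ∀ a b c d : ℚ, 0 < a * d - b * c → σ * ((c : ℂ) * τ + (d : ℂ)) ≠ (a : ℂ) * τ + (b : ℂ)) →
    let q₁ := Complex.exp (2 * Real.pi * Complex.I * τ₁)
    let q₂ := Complex.exp (2 * Real.pi * Complex.I * τ₂)
    (k : Cardinal) ≤ Algebra.trdeg ℚ ↥(IntermediateField.adjoin ℚ
      ({q₁, q₂, ramP q₁, ramQ q₁, ramR q₁, ramP q₂, ramQ q₂, ramR q₂,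
        ramP (q₁ * q₂), ramQ (q₁ * q₂), ramR (q₁ * q₂)} : Set ℂ))

/-! ## Decomposition D-1 (b1 census), re-typed: pure elliptic GPC piece + toric bridge -/

/-- The envelope of the crux in the sketch's spelling. -/
def Env (m : ℕ) (w : Fin m → ℂ) : IntermediateField ℚ ℂ :=
  IntermediateField.adjoin ℚ (Set.range w ∪ Set.range (Complex.exp ∘ w) ∪
    Set.range (fun j => ramP (Complex.exp (w j))) ∪ Set.range (fun j => ramQ (Complex.exp (w j))) ∪
    Set.range (fun j => ramR (Complex.exp (w j))))

/-- The exponential-free (pure) sub-envelope `ℚ(w, P, Q, R) = ℚ(2πi, τ, E₂, E₄, E₆(τⱼ))`. -/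
def EnvPure (m : ℕ) (w : Fin m → ℂ) : IntermediateField ℚ ℂ :=
  IntermediateField.adjoin ℚ (Set.range w ∪
    Set.range (fun j => ramP (Complex.exp (w j))) ∪ Set.range (fun j => ramQ (Complex.exp (w j))) ∪
    Set.range (fun j => ramR (Complex.exp (w j))))

/-- **TateEllipticGPC** (André's GPC for the pure motive `⊕ⱼ h¹(E_{τⱼ})`, `dim G_mot = 3m+1`, on the
Tate locus): `3m + 1 ≤ trdeg ℚ(w, P, Q, R)`.  Strictly weaker than the crux; exponential-free; implies
`ModularHermite` and `JExpTranscendental`; known part `2` (Chudnovsky); no method beyond. -/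
def TateEllipticGPC : Prop :=
  ∀ (m : ℕ) (w : Fin m → ℂ), TatePosition m w → ((3 * m + 1 : ℕ) : Cardinal) ≤ Algebra.trdeg ℚ ↥(EnvPure m w)

/-- **TateToricBridge**: the `m − 1` multiplicatively independent nomes raise the pure bound to `4m`
(relative Lindemann–Weierstrass over the period field, in bridge form so that no budget is fixed). -/
def TateToricBridge : Prop :=
  ∀ (m : ℕ) (w : Fin m → ℂ), TatePosition m w →
    ((3 * m + 1 : ℕ) : Cardinal) ≤ Algebra.trdeg ℚ ↥(EnvPure m w) →
      ((4 * m : ℕ) : Cardinal) ≤ Algebra.trdeg ℚ ↥(Env m w)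

/-- The crux in the sketch's spelling (definitionally the route decl, see `crux_iff`). -/
def CruxSpelled : Prop :=
  ∀ (m : ℕ) (w : Fin m → ℂ), TatePosition m w → ((4 * m : ℕ) : Cardinal) ≤ Algebra.trdeg ℚ ↥(Env m w)

/-- The sketch's spelling is the route decl, by `Iff` of curried/uncurried hypotheses. -/
theorem crux_iff : TateLocusGPC ↔ CruxSpelled := by
  constructor
  · intro h m w hw
    exact h m w hw.1 hw.2.1 hw.2.2.1 hw.2.2.2.1 hw.2.2.2.2
  · intro h m w h1 h2 h3 h4 h5
    exact h m w ⟨h1, h2, h3, h4, h5⟩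

/-- Glue of D-1: the two pieces give the crux (two lines). -/
theorem tateLocusGPC_of_subs (hE : TateEllipticGPC) (hB : TateToricBridge) : TateLocusGPC :=
  crux_iff.2 fun m w hw => hB m w hw (hE m w hw)

/-- The bridge is implied by the crux (it is the crux conditioned on a hypothesis). -/
theorem tateToricBridge_of_crux (h : TateLocusGPC) : TateToricBridge :=
  fun m w hw _ => crux_iff.1 h m w hw

end Summit.Schanuel.Schanuel.Cruxes.TateLocusGPC.StrategistG1
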